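import Summits.QuantumFields.YangMills.Theorems.ColdStartUniversalityEntropySubadditivity
import Mathlib.MeasureTheory.Constructions.Pi
import HarnessLib

/-!
# Route `ColdStartUniversality` (fixed-cut-off package, entropy side): n-FOLD SUB-ADDITIVITY (TENSORISATION) OF ENTROPY over a
# finite product `Measure.pi μ` of probability spaces (Bakry–Gentil–Ledoux Prop. 5.2.7, `n` factors)

Helper file (seat `ym-line-csu-p1`, g22; `--supports stmt-QuantumFields-27363`), abstract measure theory in the toolkit namespace
`…ColdStartUniversality.EntropyFlow` (no SZZ object), sequel of `…EntropySubadditivity` (two factors).  For a finite index type `ι`,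
probability measures `μ i` on `X i`, `π = Measure.pi μ`, a measurable `f : (Π i, X i) → ℝ` with `0 < δ ≤ f ≤ M`, `φ(u) = u log u`,
`Ent_ρ(g) = ∫ φ(g) dρ − φ(∫ g dρ)` and the COORDINATE ENTROPIES `Ent_i(f)(x) = Ent_{μ i}(t ↦ f(update x i t))`:

* `map_update_prod_pi` — RESAMPLING ONE COORDINATE PRESERVES THE PRODUCT MEASURE: the image of `π ⊗ μ i` under
  `(x, t) ↦ update x i t` is `π`; `integral_integral_update` — `∫ (∫ g(update x i t) dμ i(t)) dπ(x) = ∫ g dπ`;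
* `entropy_pi_le_of_forall_update_eq` — the induction on the set `s` of coordinates `f` depends on;
* ★★ `entropy_pi_le` — SUB-ADDITIVITY `Ent_π(f) ≤ Σ_i ∫ Ent_i(f)(x) dπ(x)`.

Proof (type-stable induction on a `Finset` of coordinates, everything on the full product): integrating out one coordinate,
`g = E_i f`, `Ent_π(f) = Ent_π(g) + ∫ Ent_i(f) dπ` EXACTLY (resampling invariance), `g` depends on one coordinate less, and for
`j ≠ i` `Ent_j(E_i f) ≤ E_i(Ent_j f)` pointwise — the two-factor CONVEXITY `EntropyFlow.entropy_marginal_le` (g21) on `X j × X i`.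
With the one-factor log-Sobolev inequalities inside the coordinate entropies this is the tensorisation of log-Sobolev inequalities
(used next door for product Haar measure on `SU(2)^E`).  THEOREMS ONLY, no definition, no sorry, [cite] BGL Prop. 5.2.7.
Nothing here is specific to Yang–Mills; no crux, rung or summit statement is proved; the Yang–Mills mass gap is NOT proved.
-/

set_option autoImplicit false

noncomputable section

namespace Summit.QuantumFields.YangMills.Theorems.ColdStartUniversality.EntropyFlow

open MeasureTheory Filter Set Topology Real Function
open scoped NNReal ENNReal BigOperators

section Pi

variable {ι : Type*} [Fintype ι] [DecidableEq ι] {X : ι → Type*} [∀ i, MeasurableSpace (X i)]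
  (μ : ∀ i, Measure (X i)) [∀ i, IsProbabilityMeasure (μ i)]

/-! ## §1. Resampling one coordinate preserves the product measure -/

/-- **Resampling one coordinate preserves the product measure**: for probability measures `μ i`, the image of
`(Measure.pi μ) ⊗ (μ i)` under `(x, t) ↦ update x i t` is `Measure.pi μ` (both give a box `Π_j s_j` mass `Π_j μ_j(s_j)`).
[folklore] -/
theorem map_update_prod_pi (i : ι) :
    ((Measure.pi μ).prod (μ i)).map (fun p : (Π j, X j) × X i => update p.1 i p.2) = Measure.pi μ := by
  symm
  refine Measure.pi_eq fun s hs => ?_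
  rw [Measure.map_apply measurable_update' (MeasurableSet.univ_pi hs)]
  have hpre : (fun p : (Π j, X j) × X i => update p.1 i p.2) ⁻¹' (Set.univ.pi s) =
      (Set.univ.pi (update s i Set.univ)) ×ˢ (s i) := by
    ext ⟨x, t⟩
    simp only [Set.mem_preimage, Set.mem_univ_pi, Set.mem_prod]
    constructor
    · intro h
      refine ⟨fun j => ?_, by simpa using h i⟩
      by_cases hj : j = i
      · subst hj; simp
      · rw [update_of_ne hj]
        have := h j
        rwa [update_of_ne hj] at this
    · rintro ⟨h1, h2⟩ j
      by_cases hj : j = i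
      · subst hj; simpa using h2
      · rw [update_of_ne hj]
        have := h1 j
        rwa [update_of_ne hj] at this
  rw [hpre, Measure.prod_prod, Measure.pi_pi, ← Finset.mul_prod_erase _ _ (Finset.mem_univ i),
    ← Finset.mul_prod_erase Finset.univ (fun j => μ j (s j)) (Finset.mem_univ i), update_self, measure_univ, one_mul,
    mul_comm]
  congr 1
  exact Finset.prod_congr rfl fun j hj => by rw [update_of_ne (Finset.ne_of_mem_erase hj)]

/-- The resampling map `(x, t) ↦ update x i t` is measure preserving `π ⊗ μ i → π`. [folklore] -/
theorem measurePreserving_update (i : ι) :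
    MeasurePreserving (fun p : (Π j, X j) × X i => update p.1 i p.2) ((Measure.pi μ).prod (μ i)) (Measure.pi μ) :=
  ⟨measurable_update', map_update_prod_pi μ i⟩

/-- **`∫ (∫ g(update x i t) dμ i(t)) dπ(x) = ∫ g dπ`** for every `π`-integrable `g` (`π = Measure.pi μ`): integrating out a
coordinate and integrating again is integrating. [folklore] -/
theorem integral_integral_update (i : ι) {g : (Π j, X j) → ℝ} (hg : Integrable g (Measure.pi μ)) :
    ∫ x, (∫ t, g (update x i t) ∂μ i) ∂Measure.pi μ = ∫ x, g x ∂Measure.pi μ := by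
  have hmp := measurePreserving_update μ i
  have hgc : Integrable (fun p : (Π j, X j) × X i => g (update p.1 i p.2)) ((Measure.pi μ).prod (μ i)) :=
    hmp.integrable_comp_of_integrable hg
  calc ∫ x, (∫ t, g (update x i t) ∂μ i) ∂Measure.pi μ
      = ∫ p, g (update p.1 i p.2) ∂(Measure.pi μ).prod (μ i) := (integral_prod _ hgc).symm
    _ = ∫ x, g x ∂((Measure.pi μ).prod (μ i)).map (fun p : (Π j, X j) × X i => update p.1 i p.2) := by
        rw [integral_map measurable_update'.aemeasurable]
        rw [hmp.map_eq]; exact hg.aestronglyMeasurable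
    _ = ∫ x, g x ∂Measure.pi μ := by rw [hmp.map_eq]

omit [Fintype ι] in
/-- Measurability of `x ↦ ∫ g(update x i t) dμ i(t)` for measurable real `g`. [folklore] -/
theorem measurable_integral_update (i : ι) {g : (Π j, X j) → ℝ} (hg : Measurable g) :
    Measurable fun x : Π j, X j => ∫ t, g (update x i t) ∂μ i :=
  ((hg.comp measurable_update').stronglyMeasurable.integral_prod_right' (ν := μ i)).measurable

/-- A bounded measurable real function is integrable for a probability measure. [folklore] -/
theorem integrable_of_abs_le {Y : Type*} [MeasurableSpace Y] (ρ : Measure Y) [IsFiniteMeasure ρ] {g : Y → ℝ}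
    (hg : Measurable g) {B : ℝ} (hB : ∀ y, |g y| ≤ B) : Integrable g ρ :=
  Integrable.of_bound hg.aestronglyMeasurable B (ae_of_all _ fun y => by rw [Real.norm_eq_abs]; exact hB y)

/-- `|∫ g dρ| ≤ B` when `|g| ≤ B` and `ρ` is a probability measure. [folklore] -/
theorem abs_integral_le_of_abs_le {Y : Type*} [MeasurableSpace Y] (ρ : Measure Y) [IsProbabilityMeasure ρ] {g : Y → ℝ}
    {B : ℝ} (hB : ∀ y, |g y| ≤ B) : |∫ y, g y ∂ρ| ≤ B := by
  have h := norm_integral_le_of_norm_le_const (μ := ρ) (f := g) (C := B)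
    (ae_of_all _ fun y => by rw [Real.norm_eq_abs]; exact hB y)
  rwa [Real.norm_eq_abs, probReal_univ, mul_one] at h

/-! ## §2. A function of finitely many coordinates that depends on none of them is constant -/

omit [Fintype ι] [∀ i, MeasurableSpace (X i)] in
/-- If `f(update x j t) = f x` for all `j, x, t` then `f` is constant (two points differ in finitely many coordinates —
induction on a `Finset`). [folklore] -/
theorem eq_of_forall_update_eq [Fintype ι] {f : (Π j, X j) → ℝ} (hdep : ∀ j (x : Π j, X j) (t : X j), f (update x j t) = f x)
    (x y : Π j, X j) : f y = f x := by
  suffices h : ∀ s : Finset ι, f (fun j => if j ∈ s then y j else x j) = f x by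
    have := h Finset.univ
    simpa using this
  intro s
  induction s using Finset.induction_on with
  | empty => simp
  | insert j s hj ih =>
    have e : (fun k => if k ∈ insert j s then y k else x k) =
        update (fun k => if k ∈ s then y k else x k) j (y j) := by
      funext k
      by_cases hk : k = j
      · subst hk; simp
      · rw [update_of_ne hk]; simp [Finset.mem_insert, hk]
    rw [e, hdep, ih]

/-! ## §3. Sub-additivity of the entropy over `Measure.pi` -/

/-- **The induction.**  For a measurable `f : (Π j, X j) → ℝ` with `0 < δ ≤ f ≤ M` depending only on the coordinates in the
finite set `s` (`f(update x j t) = f x` for `j ∉ s`),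
`Ent_π(f) ≤ Σ_{i ∈ s} ∫ Ent_{μ i}(t ↦ f(update x i t)) dπ(x)`, `π = Measure.pi μ`.  Step `s → insert i s`: with `g = E_i f`
(`g x = ∫ f(update x i t) dμ i`), `Ent_π(f) = Ent_π(g) + ∫ Ent_i(f) dπ` by resampling invariance (`integral_integral_update`), `g`
depends only on `s`, and `Ent_j(g) ≤ E_i(Ent_j f)` pointwise for `j ≠ i` by the two-factor convexity `entropy_marginal_le`.
[cite: BakryGentilLedoux2014, Prop. 5.2.7] -/
theorem entropy_pi_le_of_forall_update_eq {δ M : ℝ} (hδ : 0 < δ) (s : Finset ι) :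
    ∀ (f : (Π j, X j) → ℝ), Measurable f → (∀ x, δ ≤ f x) → (∀ x, f x ≤ M) →
      (∀ j, j ∉ s → ∀ (x : Π j, X j) (t : X j), f (update x j t) = f x) →
      (∫ x, f x * Real.log (f x) ∂Measure.pi μ) - (∫ x, f x ∂Measure.pi μ) * Real.log (∫ x, f x ∂Measure.pi μ) ≤
        ∑ i ∈ s, ∫ x, ((∫ t, f (update x i t) * Real.log (f (update x i t)) ∂μ i) -
          (∫ t, f (update x i t) ∂μ i) * Real.log (∫ t, f (update x i t) ∂μ i)) ∂Measure.pi μ := by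
  -- a uniform bound for `log` on `[δ, M]`
  obtain ⟨C, hC⟩ := (isCompact_Icc (a := δ) (b := M)).exists_bound_of_continuousOn
    (Real.continuousOn_log.mono fun u hu => ne_of_gt (lt_of_lt_of_le hδ hu.1))
  have hlogC : ∀ u, δ ≤ u → u ≤ M → |Real.log u| ≤ C := fun u h1 h2 => by
    have := hC u ⟨h1, h2⟩; rwa [Real.norm_eq_abs] at this
  -- generic facts about admissible functions (valid on every probability space)
  have hφb : ∀ u, δ ≤ u → u ≤ M → |u * Real.log u| ≤ M * C := fun u h1 h2 => by
    rw [abs_mul, abs_of_pos (lt_of_lt_of_le hδ h1)]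
    exact mul_le_mul h2 (hlogC u h1 h2) (abs_nonneg _) ((hδ.le.trans h1).trans h2)
  have hmean : ∀ (j : ι) (g : X j → ℝ),
      Measurable g → (∀ y, δ ≤ g y) → (∀ y, g y ≤ M) → δ ≤ ∫ y, g y ∂μ j ∧ ∫ y, g y ∂μ j ≤ M := by
    intro j g hg h1 h2
    have hgi : Integrable g (μ j) := integrable_of_abs_le (μ j) hg (B := M) fun y => by
      rw [abs_of_pos (lt_of_lt_of_le hδ (h1 y))]; exact h2 y
    constructor
    · have := integral_mono (integrable_const δ) hgi h1
      rwa [integral_const, probReal_univ, one_smul] at this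
    · have := integral_mono hgi (integrable_const M) h2
      rwa [integral_const, probReal_univ, one_smul] at this
  have hEntb : ∀ (j : ι) (g : X j → ℝ),
      Measurable g → (∀ y, δ ≤ g y) → (∀ y, g y ≤ M) →
      |(∫ y, g y * Real.log (g y) ∂μ j) - (∫ y, g y ∂μ j) * Real.log (∫ y, g y ∂μ j)| ≤ M * C + M * C := by
    intro j g hg h1 h2
    obtain ⟨hm1, hm2⟩ := hmean j g hg h1 h2
    exact (abs_sub _ _).trans (add_le_add (abs_integral_le_of_abs_le (μ j) fun y => hφb _ (h1 y) (h2 y)) (hφb _ hm1 hm2))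
  -- the induction
  induction s using Finset.induction_on with
  | empty =>
    intro f hfm hfδ hfM hdep
    rw [Finset.sum_empty]
    have hconst : ∀ x y : Π j, X j, f y = f x := eq_of_forall_update_eq (fun j x t => hdep j (by simp) x t)
    rcases isEmpty_or_nonempty (Π j, X j) with hE | hE
    · have e : ∀ g : (Π j, X j) → ℝ, ∫ x, g x ∂Measure.pi μ = 0 := fun g => by
        rw [Measure.eq_zero_of_isEmpty (Measure.pi μ)]; simp
      simp only [e]; simp
    · obtain ⟨x₀⟩ := hE
      have ef : f = fun _ => f x₀ := funext fun y => hconst x₀ y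
      rw [ef]
      simp only [integral_const, probReal_univ, one_smul, sub_self, le_refl]
  | insert i s hi ih =>
    intro f hfm hfδ hfM hdep
    set ν : Measure (Π j, X j) := Measure.pi μ with hν
    have hfpos : ∀ x, 0 < f x := fun x => lt_of_lt_of_le hδ (hfδ x)
    have hfb : ∀ x, |f x| ≤ M := fun x => by rw [abs_of_pos (hfpos x)]; exact hfM x
    have hflm : Measurable fun x => f x * Real.log (f x) := hfm.mul (Real.measurable_log.comp hfm)
    -- `g = E_i f`
    set g : (Π j, X j) → ℝ := fun x => ∫ t, f (update x i t) ∂μ i with hg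
    have hgm : Measurable g := measurable_integral_update μ i hfm
    have hgδM : ∀ x, δ ≤ g x ∧ g x ≤ M := fun x =>
      hmean i (fun t => f (update x i t)) (hfm.comp (measurable_update x)) (fun t => hfδ _) (fun t => hfM _)
    have hgδ : ∀ x, δ ≤ g x := fun x => (hgδM x).1
    have hgM : ∀ x, g x ≤ M := fun x => (hgδM x).2
    have hgdep : ∀ j, j ∉ s → ∀ (x : Π j, X j) (t : X j), g (update x j t) = g x := by
      intro j hj x t
      by_cases hji : j = i
      · subst hji
        simp only [hg, update_idem]
      · have hj' : j ∉ insert i s := by simp [hj, hji]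
        simp only [hg]
        refine integral_congr_ae (ae_of_all _ fun t' => ?_)
        show f (update (update x j t) i t') = f (update x i t')
        rw [update_comm hji, hdep j hj']
    have hIH := ih g hgm hgδ hgM hgdep
    -- integrability on `π`
    have i_f : Integrable f ν := integrable_of_abs_le ν hfm hfb
    have i_fl : Integrable (fun x => f x * Real.log (f x)) ν :=
      integrable_of_abs_le ν hflm fun x => hφb _ (hfδ x) (hfM x)
    have hglm : Measurable fun x => g x * Real.log (g x) := hgm.mul (Real.measurable_log.comp hgm)
    have i_gl : Integrable (fun x => g x * Real.log (g x)) ν :=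
      integrable_of_abs_le ν hglm fun x => hφb _ (hgδ x) (hgM x)
    -- the coordinate entropies of `f` and `g` are bounded measurable
    have hEm : ∀ (j : ι) (h : (Π j, X j) → ℝ), Measurable h →
        Measurable fun x => (∫ t, h (update x j t) * Real.log (h (update x j t)) ∂μ j) -
          (∫ t, h (update x j t) ∂μ j) * Real.log (∫ t, h (update x j t) ∂μ j) := by
      intro j h hh
      have h1 : Measurable fun x => ∫ t, h (update x j t) * Real.log (h (update x j t)) ∂μ j :=
        measurable_integral_update μ j (g := fun x => h x * Real.log (h x)) (hh.mul (Real.measurable_log.comp hh))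
      have h2 : Measurable fun x => ∫ t, h (update x j t) ∂μ j := measurable_integral_update μ j hh
      exact h1.sub (h2.mul (Real.measurable_log.comp h2))
    have hEb : ∀ (j : ι) (h : (Π j, X j) → ℝ), Measurable h → (∀ x, δ ≤ h x) → (∀ x, h x ≤ M) → ∀ x,
        |(∫ t, h (update x j t) * Real.log (h (update x j t)) ∂μ j) -
          (∫ t, h (update x j t) ∂μ j) * Real.log (∫ t, h (update x j t) ∂μ j)| ≤ M * C + M * C :=
      fun j h hh h1 h2 x => hEntb j (fun t => h (update x j t)) (hh.comp (measurable_update x)) (fun t => h1 _) (fun t => h2 _)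
    have i_Ef : ∀ j, Integrable (fun x => (∫ t, f (update x j t) * Real.log (f (update x j t)) ∂μ j) -
        (∫ t, f (update x j t) ∂μ j) * Real.log (∫ t, f (update x j t) ∂μ j)) ν :=
      fun j => integrable_of_abs_le ν (hEm j f hfm) (hEb j f hfm hfδ hfM)
    have i_Eg : ∀ j, Integrable (fun x => (∫ t, g (update x j t) * Real.log (g (update x j t)) ∂μ j) -
        (∫ t, g (update x j t) ∂μ j) * Real.log (∫ t, g (update x j t) ∂μ j)) ν :=
      fun j => integrable_of_abs_le ν (hEm j g hgm) (hEb j g hgm hgδ hgM)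
    -- (a) the chain rule `Ent_π(f) = Ent_π(g) + ∫ Ent_i(f) dπ`
    have hmass : ∫ x, g x ∂ν = ∫ x, f x ∂ν := integral_integral_update μ i i_f
    have hφ : ∫ x, f x * Real.log (f x) ∂ν = ∫ x, (∫ t, f (update x i t) * Real.log (f (update x i t)) ∂μ i) ∂ν :=
      (integral_integral_update μ i i_fl).symm
    have i_φi : Integrable (fun x => ∫ t, f (update x i t) * Real.log (f (update x i t)) ∂μ i) ν :=
      integrable_of_abs_le ν (measurable_integral_update μ i (g := fun x => f x * Real.log (f x)) hflm)
        fun x => abs_integral_le_of_abs_le (μ i) fun t => hφb _ (hfδ _) (hfM _)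
    have ha : (∫ x, f x * Real.log (f x) ∂ν) - (∫ x, f x ∂ν) * Real.log (∫ x, f x ∂ν) =
        ((∫ x, g x * Real.log (g x) ∂ν) - (∫ x, g x ∂ν) * Real.log (∫ x, g x ∂ν)) +
        ∫ x, ((∫ t, f (update x i t) * Real.log (f (update x i t)) ∂μ i) -
          (∫ t, f (update x i t) ∂μ i) * Real.log (∫ t, f (update x i t) ∂μ i)) ∂ν := by
      rw [integral_sub i_φi i_gl, hmass, hφ]
      ring
    -- (b) convexity: `∫ Ent_j(g) dπ ≤ ∫ Ent_j(f) dπ` for `j ∈ s` (so `j ≠ i`)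
    have hb : ∀ j ∈ s, ∫ x, ((∫ t, g (update x j t) * Real.log (g (update x j t)) ∂μ j) -
          (∫ t, g (update x j t) ∂μ j) * Real.log (∫ t, g (update x j t) ∂μ j)) ∂ν ≤
        ∫ x, ((∫ t, f (update x j t) * Real.log (f (update x j t)) ∂μ j) -
          (∫ t, f (update x j t) ∂μ j) * Real.log (∫ t, f (update x j t) ∂μ j)) ∂ν := by
      intro j hj
      have hji : j ≠ i := fun h => hi (h ▸ hj)
      -- pointwise `Ent_j(g)(x) ≤ E_i(Ent_j f)(x)`
      have hpt : ∀ x, (∫ t, g (update x j t) * Real.log (g (update x j t)) ∂μ j) -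
            (∫ t, g (update x j t) ∂μ j) * Real.log (∫ t, g (update x j t) ∂μ j) ≤
          ∫ t', ((∫ t, f (update (update x i t') j t) * Real.log (f (update (update x i t') j t)) ∂μ j) -
            (∫ t, f (update (update x i t') j t) ∂μ j) * Real.log (∫ t, f (update (update x i t') j t) ∂μ j)) ∂μ i := by
        intro x
        -- the two-variable function `h(t, t') = f(update (update x j t) i t') = f(update (update x i t') j t)`
        have hhm : Measurable fun p : X j × X i => f (update (update x j p.1) i p.2) :=
          hfm.comp (measurable_update'.comp (((measurable_update x).comp measurable_fst).prodMk measurable_snd))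
        have hconv := entropy_marginal_le (μ j) (μ i) (f := fun p : X j × X i => f (update (update x j p.1) i p.2))
          hhm hδ (fun p => hfδ _) (fun p => hfM _)
        have e1 : ∀ t, g (update x j t) = ∫ t', f (update (update x j t) i t') ∂μ i := fun t => rfl
        have e2 : ∀ (t : X j) (t' : X i), f (update (update x j t) i t') = f (update (update x i t') j t) :=
          fun t t' => by rw [update_comm hji]
        simp only [e1]
        refine hconv.trans (le_of_eq ?_)
        simp only [e2]
      -- integrate and resample
      have i_R : Integrable (fun x => ∫ t', ((∫ t, f (update (update x i t') j t) * Real.log (f (update (update x i t') j t)) ∂μ j) -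
            (∫ t, f (update (update x i t') j t) ∂μ j) * Real.log (∫ t, f (update (update x i t') j t) ∂μ j)) ∂μ i) ν :=
        integrable_of_abs_le ν (measurable_integral_update μ i (hEm j f hfm))
          fun x => abs_integral_le_of_abs_le (μ i) fun t' => hEb j f hfm hfδ hfM _
      calc _ ≤ ∫ x, (∫ t', ((∫ t, f (update (update x i t') j t) * Real.log (f (update (update x i t') j t)) ∂μ j) -
            (∫ t, f (update (update x i t') j t) ∂μ j) * Real.log (∫ t, f (update (update x i t') j t) ∂μ j)) ∂μ i) ∂ν :=
            integral_mono (i_Eg j) i_R hpt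
        _ = _ := integral_integral_update μ i (i_Ef j)
    -- assemble
    rw [ha, Finset.sum_insert hi]
    have hsum := Finset.sum_le_sum hb
    linarith [hIH, hsum]

/-- ★★ **Sub-additivity (tensorisation) of the entropy over a finite product.**  For probability measures `μ i` (`i : ι` finite),
`π = Measure.pi μ` and a measurable `f : (Π i, X i) → ℝ` with `0 < δ ≤ f ≤ M`:
`Ent_π(f) ≤ Σ_i ∫ Ent_{μ i}(t ↦ f(update x i t)) dπ(x)`, `Ent_ρ(g) = ∫ g log g dρ − (∫ g dρ) log(∫ g dρ)`.
[cite: BakryGentilLedoux2014, Prop. 5.2.7] -/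
theorem entropy_pi_le {f : (Π j, X j) → ℝ} (hfm : Measurable f) {δ M : ℝ} (hδ : 0 < δ) (hfδ : ∀ x, δ ≤ f x)
    (hfM : ∀ x, f x ≤ M) :
    (∫ x, f x * Real.log (f x) ∂Measure.pi μ) - (∫ x, f x ∂Measure.pi μ) * Real.log (∫ x, f x ∂Measure.pi μ) ≤
      ∑ i, ∫ x, ((∫ t, f (update x i t) * Real.log (f (update x i t)) ∂μ i) -
        (∫ t, f (update x i t) ∂μ i) * Real.log (∫ t, f (update x i t) ∂μ i)) ∂Measure.pi μ :=
  entropy_pi_le_of_forall_update_eq μ hδ Finset.univ f hfm hfδ hfM (fun j hj => absurd (Finset.mem_univ j) hj)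

end Pi

end Summit.QuantumFields.YangMills.Theorems.ColdStartUniversality.EntropyFlow

end
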